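import Mathlib
import HarnessLib
import Literature.Analysis.FluidPDE.ClassicalSolution
import Summits.NavierStokesRegularity.NavierStokesRegularity.Theorems.QuarterLogPincerTypeIQuantSubcubicExpFrameTools

/-!
# Crux `QuarterLogPincer.TypeIQuantSubcubicExp` (stmt-NavierStokesRegularity-24077), line `thin_cascade`:
  A VIOLATOR OF THE RATE `exp(2K + A³/q + 2)` IS A CHEAP CASCADE OF LENGTH `K` AND BUDGET `q`

Helper file (`--supports stmt-NavierStokesRegularity-24077 --as helper`, lead prover ns-tc-p1) for the
registered stub `stub_cheapCascades` of the skeleton `Cruxes/TypeIQuantSubcubicExp/Lines/thin_cascade.lean`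
(v4 `972f24fcf0c3`): part (a) of the stub's plan, CASCADE FROM A VIOLATOR, with the conclusion written as
the UNFOLDED body of the line's `CheapCascade M q K` (so that this file does not depend on the line's
definitions module; the stub file repackages it by `exact`).

Statement (`cheapCascade_of_violator`).  Let `(T, τ, A, u, p)` be admissible data of the crux for the
Type-I constant `M` (Tao frame on `[0,T]`, `τ > 0`, virtual Type-I bound `‖u(t,x)‖ ≤ M (T+τ−t)^{-1/2}`,
`L³` history `‖u(t)‖₃ ≤ A`, `A ≥ 0`), let `q > 0`, `K ∈ ℕ`, and let `(t₁, x₀)`, `0 < t₁ ≤ T`, violate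
the rate `exp(2K + A³/q + 2)`: `‖u(t₁,x₀)‖ √t₁ ≥ exp(2K + A³/q + 2)`.  Then the data restricted to
`[0,t₁]` (remaining time `τ' = T − t₁ + τ`, centre `x₀`, base scale `ρ = e^{i₀} r₀`,
`r₀ = 1/‖u(t₁,x₀)‖`) are a cheap cascade of length `K`, Type-I constant `M` and budget `q`.

Proof.  `r₀‖u(t₁,x₀)‖ = 1` and the Type-I clause at `(t₁,x₀)` give `τ' ≤ M² r₀²`.  Put
`Φ(b) = ∫_{r₀ ≤ |x−x₀| < b} ‖u(t₁)‖³ ≤ A³` and `φ(i) = Φ(eⁱ r₀)`.  BOOKKEEPING (`exists_good_start`,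
replacing the rising-sun lemma of the card): with `L = ⌈A³/q⌉` let `i₀` maximise `φ(i) − q i` over
`K ≤ i ≤ 2K + L + 1`; the top `K` indices are beaten by `i = K` (`φ ≤ A³ ≤ qL`), so `i₀ ≤ K + L + 1`,
every window `i₀ + j`, `j ≤ K`, stays in range, and maximality reads `φ(i₀+j) − φ(i₀) ≤ q j`, which
dominates the open annulus `e^{i₀}r₀ < |x−x₀| < e^{i₀+j}r₀` (`lintegral_openShell_le_ofReal_sub`).
Backward life: `e^{2K}ρ² = e^{2(K+i₀)} r₀² ≤ t₁ = (‖u‖√t₁)² r₀²` because `K + i₀ ≤ 2K + L + 1 <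
2K + A³/q + 2 ≤ log(‖u‖√t₁)`; remaining time: `τ' ≤ M² r₀² ≤ M² e^{2(i₀−K)} r₀²` as `i₀ ≥ K`; centre:
`ρ‖u(t₁,x₀)‖ = e^{i₀} ≥ e^{K}`; the frame and the Type-I clause restrict in time (`frame_restrict`,
`typeI_restrict`).

HONEST FRAMING: elementary bookkeeping toward ONE registered stub of an open crux; no statement about
Navier–Stokes regularity is proved; the crux, the line's deciding stub (the DSS wall) and every summit
statement remain open.  No summit statement is proved by this file.
-/

noncomputable section

-- the summit-side namespace `Summit.NavierStokesRegularity.NavierStokesRegularity.…` (single-conjunct summit,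
-- D-0017) repeats a component by design; the dupNamespace linter would flag every declaration.
set_option linter.dupNamespace false

namespace Summit.NavierStokesRegularity.NavierStokesRegularity.Theorems.ThinCascade

open MeasureTheory Set
open scoped ENNReal
open Literature.Analysis.FluidPDE

/-! ### Shell bookkeeping -/

/-- An open annulus `b < |x−x₀| < c` and the half-open shell `r₀ ≤ |x−x₀| < b` below it are disjoint
pieces of the shell `r₀ ≤ |x−x₀| < c` (`r₀ ≤ b ≤ c`): their masses add up to at most the big shell's.
[folklore] -/
theorem lintegral_openShell_add_le {Y : Type*} [NormedAddCommGroup Y] [MeasurableSpace Y]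
    [OpensMeasurableSpace Y] (μ : Measure Y) (g : Y → ℝ≥0∞) (x₀ : Y) {r₀ b c : ℝ}
    (hb : r₀ ≤ b) (hbc : b ≤ c) :
    (∫⁻ x in {x | b < ‖x - x₀‖ ∧ ‖x - x₀‖ < c}, g x ∂μ) +
        ∫⁻ x in {x | r₀ ≤ ‖x - x₀‖ ∧ ‖x - x₀‖ < b}, g x ∂μ ≤
      ∫⁻ x in {x | r₀ ≤ ‖x - x₀‖ ∧ ‖x - x₀‖ < c}, g x ∂μ := by
  have hd : Measurable fun x : Y => ‖x - x₀‖ :=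
    (continuous_norm.comp (continuous_sub_right x₀)).measurable
  have hmeas : MeasurableSet {x : Y | r₀ ≤ ‖x - x₀‖ ∧ ‖x - x₀‖ < b} := by
    rw [setOf_and]
    exact (measurableSet_le measurable_const hd).inter (measurableSet_lt hd measurable_const)
  have hdisj : Disjoint {x : Y | b < ‖x - x₀‖ ∧ ‖x - x₀‖ < c}
      {x | r₀ ≤ ‖x - x₀‖ ∧ ‖x - x₀‖ < b} := by
    rw [disjoint_left]
    rintro x ⟨h1, -⟩ ⟨-, h2⟩
    exact lt_irrefl _ (h1.trans h2)
  rw [← lintegral_union hmeas hdisj]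
  refine lintegral_mono_set ?_
  rintro x (⟨h1, h2⟩ | ⟨h1, h2⟩)
  · exact ⟨hb.trans h1.le, h2⟩
  · exact ⟨h1, h2.trans_le hbc⟩

/-- The open annulus `b < |x−x₀| < c` costs at most the DIFFERENCE of the shell masses
`Φ(c) − Φ(b)`, `Φ(s) = ∫_{r₀ ≤ |x−x₀| < s} g`, in real currency, when `Φ(c) < ∞` (`r₀ ≤ b ≤ c`).
[folklore] -/
theorem lintegral_openShell_le_ofReal_sub {Y : Type*} [NormedAddCommGroup Y] [MeasurableSpace Y]
    [OpensMeasurableSpace Y] (μ : Measure Y) (g : Y → ℝ≥0∞) (x₀ : Y) {r₀ b c : ℝ}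
    (hb : r₀ ≤ b) (hbc : b ≤ c) (hfin : ∫⁻ x in {x | r₀ ≤ ‖x - x₀‖ ∧ ‖x - x₀‖ < c}, g x ∂μ ≠ ⊤) :
    ∫⁻ x in {x | b < ‖x - x₀‖ ∧ ‖x - x₀‖ < c}, g x ∂μ ≤
      ENNReal.ofReal ((∫⁻ x in {x | r₀ ≤ ‖x - x₀‖ ∧ ‖x - x₀‖ < c}, g x ∂μ).toReal -
        (∫⁻ x in {x | r₀ ≤ ‖x - x₀‖ ∧ ‖x - x₀‖ < b}, g x ∂μ).toReal) := by
  have h := lintegral_openShell_add_le μ g x₀ hb hbc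
  set X1 := ∫⁻ x in {x | b < ‖x - x₀‖ ∧ ‖x - x₀‖ < c}, g x ∂μ
  set Pb := ∫⁻ x in {x | r₀ ≤ ‖x - x₀‖ ∧ ‖x - x₀‖ < b}, g x ∂μ
  set Pc := ∫⁻ x in {x | r₀ ≤ ‖x - x₀‖ ∧ ‖x - x₀‖ < c}, g x ∂μ
  have hPb_le : Pb ≤ Pc := le_trans (self_le_add_left Pb X1) h
  have hPb : Pb ≠ ⊤ := ne_top_of_le_ne_top hfin hPb_le
  rw [← ENNReal.toReal_sub_of_le hPb_le hfin, ENNReal.ofReal_toReal (ENNReal.sub_ne_top hfin)]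
  exact ENNReal.le_sub_of_add_le_right hPb h

/-- THE GOOD START (replaces the discrete rising-sun lemma of the card).  For any `φ : ℕ → [0, B]`,
`q > 0` and `B ≤ q L`, some index `i₀ ∈ [K, K + L + 1]` has all forward increments of length `j ≤ K`
bounded by `q j`: take `i₀` maximising `φ(i) − q i` on `[K, 2K + L + 1]`; the top `K` indices lose to
`i = K`, so every window stays inside the range. [folklore] -/
theorem exists_good_start (φ : ℕ → ℝ) {B q : ℝ} (hq : 0 < q) (hφ0 : ∀ i, 0 ≤ φ i)
    (hφB : ∀ i, φ i ≤ B) (K L : ℕ) (hL : B ≤ q * L) :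
    ∃ i₀ : ℕ, K ≤ i₀ ∧ i₀ ≤ K + L + 1 ∧
      ∀ j : ℕ, 1 ≤ j → j ≤ K → φ (i₀ + j) - φ i₀ ≤ q * j := by
  classical
  obtain ⟨i₀, hi₀R, hmax⟩ := Finset.exists_max_image (Finset.Icc K (2 * K + L + 1))
    (fun i => φ i - q * i) ⟨K, Finset.mem_Icc.2 ⟨le_rfl, by omega⟩⟩
  obtain ⟨hKi₀, hi₀top⟩ := Finset.mem_Icc.1 hi₀R
  have hi₀ : i₀ ≤ K + L + 1 := by
    by_contra hcon
    have hK : φ K - q * K ≤ φ i₀ - q * i₀ := hmax K (Finset.mem_Icc.2 ⟨le_rfl, by omega⟩)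
    have h1 : (K : ℝ) + L + 2 ≤ i₀ := by exact_mod_cast (show K + L + 2 ≤ i₀ by omega)
    have h2 := mul_le_mul_of_nonneg_left h1 hq.le
    linarith [hφ0 K, hφB i₀]
  refine ⟨i₀, hKi₀, hi₀, fun j hj1 hjK => ?_⟩
  have := hmax (i₀ + j) (Finset.mem_Icc.2 ⟨by omega, by omega⟩)
  push_cast at this
  linarith

/-! ### Cascade from a violator -/

/-- **CASCADE FROM A VIOLATOR.**  Admissible data `(T, τ, A, u, p)` of the crux for the Type-I constant
`M` and a point `(t₁, x₀)`, `0 < t₁ ≤ T`, with `‖u(t₁,x₀)‖ √t₁ ≥ exp(2K + A³/q + 2)` (`q > 0`) yield —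
by restriction to `[0,t₁]`, remaining time `T − t₁ + τ`, centre `x₀`, base scale `e^{i₀}/‖u(t₁,x₀)‖`
for the good start `i₀` — the unfolded body of the line's `CheapCascade M q K`. [folklore] -/
theorem cheapCascade_of_violator {M T τ A q : ℝ} {K : ℕ}
    {u : ℝ → EuclideanSpace ℝ (Fin 3) → EuclideanSpace ℝ (Fin 3)}
    {p : ℝ → EuclideanSpace ℝ (Fin 3) → ℝ}
    (hframe : IsClassicalNSSolutionOn (Icc 0 T) 1 0 u p ∧
      ∀ n : ℕ, ∃ C : NNReal, ∀ t ∈ Icc 0 T, eLpNorm (iteratedFDeriv ℝ n (u t)) 2 volume ≤ C)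
    (hτ : 0 < τ)
    (htypeI : ∀ t ∈ Icc 0 T, ∀ x : EuclideanSpace ℝ (Fin 3),
      ‖u t x‖ ≤ M * (T + τ - t) ^ (-(1 / 2 : ℝ)))
    (hL3 : ∀ t ∈ Icc 0 T, eLpNorm (u t) 3 volume ≤ ENNReal.ofReal A) (hA : 0 ≤ A)
    (hq : 0 < q) {t₁ : ℝ} (ht₁ : t₁ ∈ Ioc 0 T) {x₀ : EuclideanSpace ℝ (Fin 3)}
    (hviol : Real.exp (2 * K + A ^ 3 / q + 2) ≤ ‖u t₁ x₀‖ * Real.sqrt t₁) :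
    ∃ (T' τ' ρ : ℝ) (x₀' : EuclideanSpace ℝ (Fin 3))
      (u' : ℝ → EuclideanSpace ℝ (Fin 3) → EuclideanSpace ℝ (Fin 3))
      (p' : ℝ → EuclideanSpace ℝ (Fin 3) → ℝ),
      (IsClassicalNSSolutionOn (Icc 0 T') 1 0 u' p' ∧
        ∀ n : ℕ, ∃ C : NNReal, ∀ t ∈ Icc 0 T', eLpNorm (iteratedFDeriv ℝ n (u' t)) 2 volume ≤ C) ∧
      0 < τ' ∧ 0 < ρ ∧
      Real.exp (2 * K) * ρ ^ 2 ≤ T' ∧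
      τ' ≤ M ^ 2 * Real.exp (-2 * (K : ℝ)) * ρ ^ 2 ∧
      (∀ t ∈ Icc 0 T', ∀ x : EuclideanSpace ℝ (Fin 3),
        ‖u' t x‖ ≤ M * (T' + τ' - t) ^ (-(1 / 2 : ℝ))) ∧
      Real.exp K ≤ ρ * ‖u' T' x₀'‖ ∧
      ∀ j : ℕ, 1 ≤ j → j ≤ K →
        ∫⁻ x in {x : EuclideanSpace ℝ (Fin 3) | ρ < ‖x - x₀'‖ ∧ ‖x - x₀'‖ < Real.exp j * ρ},
            ENNReal.ofReal (‖u' T' x‖ ^ 3) ≤ ENNReal.ofReal (q * j) := by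
  obtain ⟨ht₁0, ht₁T⟩ := ht₁
  -- the centre value `a = ‖u(t₁,x₀)‖ > 0`
  set a : ℝ := ‖u t₁ x₀‖ with ha_def
  have hsqrt : 0 < Real.sqrt t₁ := Real.sqrt_pos.2 ht₁0
  have ha : 0 < a :=
    (mul_pos_iff_of_pos_right hsqrt).1 (lt_of_lt_of_le (Real.exp_pos _) hviol)
  -- the remaining time `s = T − t₁ + τ` and the Type-I clause at `(t₁, x₀)`
  set s : ℝ := T - t₁ + τ with hs_def
  have hs : 0 < s := by rw [hs_def]; linarith
  have hTI := htypeI t₁ ⟨ht₁0.le, ht₁T⟩ x₀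
  rw [show T + τ - t₁ = s by rw [hs_def]; ring] at hTI
  obtain ⟨-, hsle⟩ := typeI_remaining_le ha hs hTI
  -- the regularity scale `r₀ = 1/a`
  set r₀ : ℝ := 1 / a with hr₀_def
  have hr₀ : 0 < r₀ := by positivity
  have har₀ : r₀ * a = 1 := by rw [hr₀_def]; field_simp
  -- shell masses
  set g : EuclideanSpace ℝ (Fin 3) → ℝ≥0∞ := fun x => ENNReal.ofReal (‖u t₁ x‖ ^ 3) with hg_def
  set Φ : ℝ → ℝ≥0∞ := fun b => ∫⁻ x in {x | r₀ ≤ ‖x - x₀‖ ∧ ‖x - x₀‖ < b}, g x with hΦ_def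
  have hΦle : ∀ b, Φ b ≤ ENNReal.ofReal (A ^ 3) := fun b =>
    (setLIntegral_le_lintegral _ _).trans
      (lintegral_cube_le_of_eLpNorm_three_le (hL3 t₁ ⟨ht₁0.le, ht₁T⟩) hA)
  have hΦfin : ∀ b, Φ b ≠ ⊤ := fun b => ne_top_of_le_ne_top ENNReal.ofReal_ne_top (hΦle b)
  set φ : ℕ → ℝ := fun i => (Φ (Real.exp i * r₀)).toReal with hφ_def
  have hφ0 : ∀ i, 0 ≤ φ i := fun i => ENNReal.toReal_nonneg
  have hφB : ∀ i, φ i ≤ A ^ 3 := fun i => by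
    have := ENNReal.toReal_mono ENNReal.ofReal_ne_top (hΦle (Real.exp i * r₀))
    rwa [ENNReal.toReal_ofReal (by positivity)] at this
  -- the good start
  set L : ℕ := ⌈A ^ 3 / q⌉₊ with hL_def
  have hL : A ^ 3 ≤ q * L := by
    have : A ^ 3 / q ≤ L := Nat.le_ceil _
    rwa [div_le_iff₀ hq, mul_comm] at this
  have hL1 : (L : ℝ) < A ^ 3 / q + 1 := Nat.ceil_lt_add_one (by positivity)
  obtain ⟨i₀, hKi₀, hi₀, hwin⟩ := exists_good_start φ hq hφ0 hφB K L hL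
  -- the window base scale `ρ = e^{i₀} r₀`
  set ρ : ℝ := Real.exp i₀ * r₀ with hρ_def
  have hρ : 0 < ρ := by positivity
  refine ⟨t₁, s, ρ, x₀, u, p, frame_restrict hframe ht₁0 ht₁T, hs, hρ, ?_, ?_,
    typeI_restrict htypeI ht₁T, ?_, ?_⟩
  · -- backward life `e^{2K} ρ² ≤ t₁`
    have hF : Real.exp ((K : ℝ) + i₀) ≤ a * Real.sqrt t₁ := by
      refine le_trans (Real.exp_le_exp.2 ?_) hviol
      have : (i₀ : ℝ) ≤ K + L + 1 := by exact_mod_cast hi₀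
      linarith
    have hF2 : Real.exp ((K : ℝ) + i₀) ^ 2 ≤ (a * Real.sqrt t₁) ^ 2 :=
      pow_le_pow_left₀ (Real.exp_pos _).le hF 2
    have e1 : Real.exp (2 * K) * ρ ^ 2 = Real.exp ((K : ℝ) + i₀) ^ 2 * r₀ ^ 2 := by
      rw [two_mul, Real.exp_add, Real.exp_add, hρ_def]; ring
    have e2 : (a * Real.sqrt t₁) ^ 2 * r₀ ^ 2 = t₁ := by
      rw [mul_pow, Real.sq_sqrt ht₁0.le]
      calc a ^ 2 * t₁ * r₀ ^ 2 = t₁ * (r₀ * a) ^ 2 := by ring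
        _ = t₁ := by rw [har₀]; ring
    rw [e1, ← e2]
    exact mul_le_mul_of_nonneg_right hF2 (sq_nonneg _)
  · -- virtual remaining time `s ≤ M² e^{-2K} ρ²`
    have h1 : (1 : ℝ) ≤ Real.exp (-2 * (K : ℝ)) * Real.exp i₀ ^ 2 := by
      rw [pow_two, ← Real.exp_add, ← Real.exp_add]
      refine Real.one_le_exp ?_
      have : (K : ℝ) ≤ i₀ := by exact_mod_cast hKi₀
      linarith
    calc s ≤ M ^ 2 * r₀ ^ 2 := hsle
      _ = M ^ 2 * r₀ ^ 2 * 1 := by ring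
      _ ≤ M ^ 2 * r₀ ^ 2 * (Real.exp (-2 * (K : ℝ)) * Real.exp i₀ ^ 2) :=
          mul_le_mul_of_nonneg_left h1 (by positivity)
      _ = M ^ 2 * Real.exp (-2 * (K : ℝ)) * ρ ^ 2 := by rw [hρ_def]; ring
  · -- centre value `e^K ≤ ρ ‖u(t₁,x₀)‖ = e^{i₀}`
    rw [hρ_def, mul_assoc, har₀, mul_one]
    exact Real.exp_le_exp.2 (by exact_mod_cast hKi₀)
  · -- annular costs
    intro j hj1 hjK
    have hw := hwin j hj1 hjK
    have e3 : Real.exp j * ρ = Real.exp ((i₀ + j : ℕ) : ℝ) * r₀ := by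
      rw [hρ_def, Nat.cast_add, Real.exp_add]; ring
    rw [e3]
    have hb : r₀ ≤ ρ :=
      le_mul_of_one_le_left hr₀.le (Real.one_le_exp (by positivity))
    have hbc : ρ ≤ Real.exp ((i₀ + j : ℕ) : ℝ) * r₀ :=
      mul_le_mul_of_nonneg_right (Real.exp_le_exp.2 (by push_cast; linarith)) hr₀.le
    refine (lintegral_openShell_le_ofReal_sub volume g x₀ hb hbc (hΦfin _)).trans ?_
    exact ENNReal.ofReal_le_ofReal hw

end Summit.NavierStokesRegularity.NavierStokesRegularity.Theorems.ThinCascade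

end
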